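import Summits.CriticalPhenomena.PercolationContinuityZ3.Theorems.PercNearOneGluingNoHeavyQuantGreedyFlow
import HarnessLib

/-!
# QUANT lane R8, T-DEC: the SW greedy credit flow — the two EXCHANGE TRANSFORMATIONS (truncation of a column; Monge uncrossing
# of one column into higher columns) and the value bookkeeping they need (lead g25, FOR-PROVERS-WINDOW-ATOMS.md §2, W2 part 2a)

builds on p205010 (kernel theorem, internal audit signed; external expert review pending)

Support file (`--supports stmt-CriticalPhenomena-4575`), QUANT lane lead seat (gen 25), rung R8 of
`run/shared/lean/prim/quant/LADDER.md`.  Theorems only, standard axioms, no sorries.  Continues `…QuantGreedyFlow`.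

THE MATHEMATICS.  Optimality of the greedy (`…QuantGreedyRowLemma` / `…QuantGreedyOptimal`) is proved by induction on the rows: the top row `l₀` must be
LEFT-PACKED, because for the remaining (smaller, hence dearer: `u l h ≥ u l₀ h`) rows
* (TRUNCATION, `exists_isFlow_truncate`) capacity `τ` at a column `h₀` is worth at most `τ / u l₀ h₀` of shipped mass — taking it away from a
  flow of the smaller rows costs at most that much (scale the column down); so the top row using its own spare mass at `h₀` never hurts;
* (UNCROSSING, `exists_isFlow_uncross`) capacity `s` at `h₀` can be traded for capacities `w_k·s·u l₀ k / u l₀ h₀` at higher columns `k` WITHOUT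
  loss — move the smaller rows' load from `h₀` to the `k`'s; by the MONGE inequality `u l₀ h₀ · u l k ≤ u l h₀ · u l₀ k` (`l < l₀`, `h₀ < k`,
  lead g21's `LawDec.usage_monge`) the moved mass fits; so the top row moving its mass from higher columns down to `h₀` never hurts.
Also: the value of the greedy splits as top row + residual greedy (`val_flow_eq`), a flow splits as top row + a flow of the other rows on the
residual capacities (`isFlow_erase_top`), and `rowFill` only reads the capacities of its own columns (`rowFill_congr`).

[this work]; Monge exchange for corner rules: classical (Hoffman 1963).  The gluing rows served [cite: KozmaNitzan2024, Conjecture 3 (p. 15)];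
product measure [cite: Grimmett1999, §1.3 p. 10].
-/

noncomputable section
namespace Summit.CriticalPhenomena.PercolationContinuityZ3.Theorems
namespace Quant
namespace LawDec
namespace Greedy

open Finset
variable (u : ℕ → ℕ → ℝ) (P : ℕ → ℕ → Prop) [DecidableRel P]

/-! ### Bookkeeping -/

/-- `rowFill` only reads the capacities of the columns it fills. [this work] -/
theorem rowFill_congr (l : ℕ) : ∀ (H : Finset ℕ) (k : ℕ) (c c' : ℕ → ℝ) (rem : ℝ), (∀ h ∈ H, c h = c' h) →
    rowFill u P l k H c rem = rowFill u P l k H c' rem := by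
  intro H
  induction H using Finset.strongInduction with
  | H H ih =>
    intro k c c' rem hcc
    by_cases hH : H.Nonempty
    · have hff : firstFill u P l H hH c rem = firstFill u P l H hH c' rem := by
        unfold firstFill; rw [hcc _ (Finset.min'_mem H hH)]
      by_cases hk : k = H.min' hH
      · rw [hk, rowFill_min', rowFill_min', hff]
      · rw [rowFill_of_ne_min' u P l k H hH c rem hk, rowFill_of_ne_min' u P l k H hH c' rem hk, hff]
        exact ih _ (Finset.erase_ssubset (Finset.min'_mem H hH)) k c c' _ (fun h hh => hcc h (Finset.mem_of_mem_erase hh))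
    · rw [Finset.not_nonempty_iff_eq_empty.1 hH, rowFill_empty, rowFill_empty]

/-- **value of the greedy = top row + residual greedy.** [this work] -/
theorem val_flow_eq (L H : Finset ℕ) (hL : L.Nonempty) (μ c : ℕ → ℝ) :
    val L H (flow u P L H μ c) =
      (∑ k ∈ H, rowFill u P (L.max' hL) k H c (μ (L.max' hL))) +
        val (L.erase (L.max' hL)) H (flow u P (L.erase (L.max' hL)) H μ (resid u P L hL H μ c)) := by
  unfold val
  rw [← Finset.add_sum_erase L _ (Finset.max'_mem L hL)]
  congr 1
  · exact Finset.sum_congr rfl fun k _ => flow_max' u P L H hL μ c k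
  · exact Finset.sum_congr rfl fun l hl => Finset.sum_congr rfl fun k _ =>
      flow_of_ne_max' u P L H hL μ c l k (Finset.ne_of_mem_erase hl)

omit [DecidableRel P] in
/-- **splitting off the top row of a flow**: the other rows are a flow on the residual capacities `c h − u l₀ h · f l₀ h`. [this work] -/
theorem isFlow_erase_top (L H : Finset ℕ) (μ c : ℕ → ℝ) (l₀ : ℕ) (hl₀ : l₀ ∈ L) (f : ℕ → ℕ → ℝ) (hf : IsFlow u P L H μ c f) :
    IsFlow u P (L.erase l₀) H μ (fun h => c h - u l₀ h * f l₀ h) (fun l h => if l = l₀ then 0 else f l h) := by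
  obtain ⟨h0, hsupp, hrow, hcol⟩ := hf
  refine ⟨fun l h => ?_, fun l h hlh => ?_, fun l hl => ?_, fun h hh => ?_⟩
  · dsimp only
    split_ifs
    · exact le_rfl
    · exact h0 l h
  · dsimp only at hlh
    by_cases hl : l = l₀
    · rw [if_pos hl] at hlh; exact (hlh rfl).elim
    · rw [if_neg hl] at hlh
      obtain ⟨h1, h2, h3⟩ := hsupp l h hlh
      exact ⟨Finset.mem_erase.2 ⟨hl, h1⟩, h2, h3⟩
  · have hne : l ≠ l₀ := Finset.ne_of_mem_erase hl
    dsimp only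
    simp only [if_neg hne]
    exact hrow l (Finset.mem_of_mem_erase hl)
  · dsimp only
    have e : ∑ l ∈ L.erase l₀, u l h * (if l = l₀ then 0 else f l h) = ∑ l ∈ L.erase l₀, u l h * f l h :=
      Finset.sum_congr rfl fun l hl => by rw [if_neg (Finset.ne_of_mem_erase hl)]
    rw [e]
    have := hcol h hh
    rw [← Finset.add_sum_erase L _ hl₀] at this
    linarith

/-- value of a flow = its top row + the value of the other rows. [this work] -/
theorem val_eq_top_add (L H : Finset ℕ) (l₀ : ℕ) (hl₀ : l₀ ∈ L) (f : ℕ → ℕ → ℝ) :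
    val L H f = (∑ k ∈ H, f l₀ k) + val (L.erase l₀) H (fun l h => if l = l₀ then 0 else f l h) := by
  unfold val
  rw [← Finset.add_sum_erase L _ hl₀]
  congr 1
  exact Finset.sum_congr rfl fun l hl => Finset.sum_congr rfl fun k _ => by
    dsimp only; rw [if_neg (Finset.ne_of_mem_erase hl)]

/-! ### Truncating one column -/

omit [DecidableRel P] in
/-- **TRUNCATION.**  Rows `L′` all dearer than `l₀` at column `h₀` (`u l₀ h₀ ≤ u l h₀` on compatible cells), `u l₀ h₀ > 0`, `c h₀ ≥ 0`, `τ ≥ 0`: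
from a flow for the capacities `c + τ·e_{h₀}` one gets a flow for `c` losing at most `τ / u l₀ h₀` of value (scale column `h₀` down).
[this work] -/
theorem exists_isFlow_truncate (L' H : Finset ℕ) (μ c : ℕ → ℝ) (l₀ h₀ : ℕ) (τ : ℝ) (hτ : 0 ≤ τ) (hc : 0 ≤ c h₀)
    (hu0 : 0 < u l₀ h₀) (hanti : ∀ l ∈ L', P l h₀ → u l₀ h₀ ≤ u l h₀) (φ : ℕ → ℕ → ℝ)
    (hφ : IsFlow u P L' H μ (fun h => if h = h₀ then c h + τ else c h) φ) :
    ∃ φ' : ℕ → ℕ → ℝ, IsFlow u P L' H μ c φ' ∧ val L' H φ - τ / u l₀ h₀ ≤ val L' H φ' := by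
  obtain ⟨h0, hsupp, hrow, hcol⟩ := hφ
  dsimp only at hcol
  set load : ℝ := ∑ l ∈ L', u l h₀ * φ l h₀ with hload
  -- each term of the load dominates `u l₀ h₀ · φ l h₀`
  have hterm : ∀ l ∈ L', u l₀ h₀ * φ l h₀ ≤ u l h₀ * φ l h₀ := by
    intro l hl
    rcases (h0 l h₀).eq_or_lt with hz | hpos
    · rw [← hz, mul_zero, mul_zero]
    · exact mul_le_mul_of_nonneg_right (hanti l hl (hsupp l h₀ hpos.ne').2.2) hpos.le
  have hload0 : 0 ≤ load := Finset.sum_nonneg fun l hl => le_trans (mul_nonneg hu0.le (h0 l h₀)) (hterm l hl)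
  have hmass : u l₀ h₀ * ∑ l ∈ L', φ l h₀ ≤ load := by
    rw [hload, Finset.mul_sum]; exact Finset.sum_le_sum hterm
  -- the scaling factor
  set θ : ℝ := if load ≤ τ then 1 else τ / load with hθ
  have hθ0 : 0 ≤ θ := by rw [hθ]; split_ifs; norm_num; exact div_nonneg hτ hload0
  have hθ1 : θ ≤ 1 := by
    rw [hθ]; split_ifs with h; exact le_rfl; rw [div_le_one (by linarith)]; linarith
  have hθload : θ * load ≤ τ := by
    rw [hθ]; split_ifs with h; linarith; rw [div_mul_cancel₀ _ (by linarith : load ≠ 0)]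
  have hcap : (1 - θ) * load ≤ c h₀ := by
    have hc0 := hcol h₀
    rw [hθ]; split_ifs with h
    · simp; exact hc
    · have hh0 : h₀ ∈ H ∨ h₀ ∉ H := em _
      rcases hh0 with hh0 | hh0
      · have := hc0 hh0; rw [if_pos rfl] at this
        have hl0 : load ≠ 0 := by linarith
        calc (1 - τ / load) * load = load - τ := by rw [sub_mul, one_mul, div_mul_cancel₀ _ hl0]
          _ ≤ c h₀ := by linarith
      · -- column outside `H`: no load at all
        have : load = 0 := Finset.sum_eq_zero fun l hl => by
          rcases (h0 l h₀).eq_or_lt with hz | hpos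
          · rw [← hz, mul_zero]
          · exact absurd (hsupp l h₀ hpos.ne').2.1 hh0
        linarith
  refine ⟨fun l h => if h = h₀ then (1 - θ) * φ l h₀ else φ l h, ⟨fun l h => ?_, fun l h hlh => ?_, fun l hl => ?_, fun h hh => ?_⟩, ?_⟩
  · dsimp only
    split_ifs
    · exact mul_nonneg (by linarith) (h0 l h₀)
    · exact h0 l h
  · dsimp only at hlh
    by_cases hh : h = h₀
    · rw [if_pos hh] at hlh; subst hh
      exact hsupp l h (by intro hz; rw [hz, mul_zero] at hlh; exact hlh rfl)
    · rw [if_neg hh] at hlh; exact hsupp l h hlh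
  · refine le_trans (Finset.sum_le_sum fun h _ => ?_) (hrow l hl)
    dsimp only
    split_ifs with hh
    · subst hh; nlinarith [h0 l h]
    · exact le_rfl
  · dsimp only
    by_cases hh0 : h = h₀
    · subst hh0
      simp only [if_true]
      calc ∑ l ∈ L', u l h * ((1 - θ) * φ l h) = (1 - θ) * load := by
            rw [hload, Finset.mul_sum]; exact Finset.sum_congr rfl fun l _ => by ring
        _ ≤ c h := hcap
    · simp only [if_neg hh0]
      have := hcol h hh; rw [if_neg hh0] at this; exact this
  · -- value: we removed `θ · Σ_l φ l h₀ ≤ θ · load / u l₀ h₀ ≤ τ / u l₀ h₀`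
    unfold val
    have e : ∀ l ∈ L', ∑ h ∈ H, (if h = h₀ then (1 - θ) * φ l h₀ else φ l h) =
        (∑ h ∈ H, φ l h) - θ * (if h₀ ∈ H then φ l h₀ else 0) := by
      intro l _
      have : ∀ h ∈ H, (if h = h₀ then (1 - θ) * φ l h₀ else φ l h) = φ l h - (if h = h₀ then θ * φ l h₀ else 0) := by
        intro h _; split_ifs with hh
        · subst hh; ring
        · ring
      rw [Finset.sum_congr rfl this, Finset.sum_sub_distrib, Finset.sum_ite_eq' H h₀]
      split_ifs <;> ring
    rw [Finset.sum_congr rfl e, Finset.sum_sub_distrib, ← Finset.mul_sum]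
    have hrem : θ * ∑ l ∈ L', (if h₀ ∈ H then φ l h₀ else 0) ≤ τ / u l₀ h₀ := by
      split_ifs with hh
      · rw [le_div_iff₀ hu0]
        calc θ * (∑ l ∈ L', φ l h₀) * u l₀ h₀ = θ * (u l₀ h₀ * ∑ l ∈ L', φ l h₀) := by ring
          _ ≤ θ * load := mul_le_mul_of_nonneg_left hmass hθ0
          _ ≤ τ := hθload
      · simp; exact div_nonneg hτ hu0.le
    linarith

/-! ### Uncrossing one column into higher columns -/

omit [DecidableRel P] in
/-- **UNCROSSING (Monge exchange).**  Rows `L′`, a column `h₀` and weights `w ≥ 0` on columns of `H` (`w h₀ = 0`, `Σ_H w = 1`) such that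
for every row `l ∈ L′` compatible with `h₀` and every weighted column `k`: `l₀` and `l` are compatible with `k` and MONGE
`u l₀ h₀·u l k ≤ u l h₀·u l₀ k` holds (rates positive on compatible cells).  Then for `0 ≤ s ≤ c h₀`, from a flow for `c` one gets a flow of
the SAME value for the capacities `c − s·e_{h₀} + Σ_k (w_k·s·u l₀ k / u l₀ h₀)·e_k` (shed the fraction `s/load` of column `h₀` into the
columns `k`, split according to `w`). [this work] -/
theorem exists_isFlow_uncross (hu : ∀ l h, P l h → 0 < u l h) (L' H : Finset ℕ) (μ c : ℕ → ℝ) (l₀ h₀ : ℕ) (s : ℝ)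
    (hs0 : 0 ≤ s) (hsc : s ≤ c h₀) (hP0 : P l₀ h₀)
    (w : ℕ → ℝ) (hw0 : ∀ k, 0 ≤ w k) (hwh : w h₀ = 0) (hwH : ∀ k, w k ≠ 0 → k ∈ H) (hw1 : ∑ k ∈ H, w k = 1)
    (hwP : ∀ k, w k ≠ 0 → P l₀ k)
    (hmonge : ∀ l ∈ L', ∀ k, w k ≠ 0 → P l h₀ → u l₀ h₀ * u l k ≤ u l h₀ * u l₀ k)
    (hcompat : ∀ l ∈ L', ∀ k, w k ≠ 0 → P l h₀ → P l k)
    (φ : ℕ → ℕ → ℝ) (hφ : IsFlow u P L' H μ c φ) :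
    ∃ φ' : ℕ → ℕ → ℝ, IsFlow u P L' H μ (fun h => c h - (if h = h₀ then s else 0) + w h * s * u l₀ h / u l₀ h₀) φ' ∧
      val L' H φ' = val L' H φ := by
  obtain ⟨h0, hsupp, hrow, hcol⟩ := hφ
  have hu0 : 0 < u l₀ h₀ := hu _ _ hP0
  set load : ℝ := ∑ l ∈ L', u l h₀ * φ l h₀ with hload
  have hPl : ∀ l, φ l h₀ ≠ 0 → l ∈ L' ∧ P l h₀ := fun l hne => ⟨(hsupp l h₀ hne).1, (hsupp l h₀ hne).2.2⟩
  have hterm0 : ∀ l, 0 ≤ u l h₀ * φ l h₀ := by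
    intro l
    rcases (h0 l h₀).eq_or_lt with hz | hpos
    · rw [← hz, mul_zero]
    · exact mul_nonneg (hu _ _ (hPl l hpos.ne').2).le hpos.le
  have hload0 : 0 ≤ load := Finset.sum_nonneg fun l _ => hterm0 l
  have hloadc : load ≤ c h₀ := by
    by_cases hh : h₀ ∈ H
    · exact hcol h₀ hh
    · have : load = 0 := Finset.sum_eq_zero fun l _ => by
        rcases (h0 l h₀).eq_or_lt with hz | hpos
        · rw [← hz, mul_zero]
        · exact absurd (hsupp l h₀ hpos.ne').2.1 hh
      linarith
  -- the shedding fraction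
  set θ : ℝ := if load ≤ s then 1 else s / load with hθ
  have hθ0 : 0 ≤ θ := by rw [hθ]; split_ifs; norm_num; exact div_nonneg hs0 hload0
  have hθ1 : θ ≤ 1 := by
    rw [hθ]; split_ifs with h; exact le_rfl; rw [div_le_one (by linarith)]; linarith
  have hθload : θ * load ≤ s := by
    rw [hθ]; split_ifs with h; linarith; rw [div_mul_cancel₀ _ (by linarith : load ≠ 0)]
  have hcap : (1 - θ) * load ≤ c h₀ - s := by
    rw [hθ]; split_ifs with h
    · linarith
    · have hl0 : load ≠ 0 := by linarith
      calc (1 - s / load) * load = load - s := by rw [sub_mul, one_mul, div_mul_cancel₀ _ hl0]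
        _ ≤ c h₀ - s := by linarith
  -- Monge bound on the load that rows of `L′` would put on a weighted column `k`
  have hmongeSum : ∀ k, w k ≠ 0 → ∑ l ∈ L', u l k * φ l h₀ ≤ u l₀ k / u l₀ h₀ * load := by
    intro k hk
    rw [hload, Finset.mul_sum]
    refine Finset.sum_le_sum fun l hl => ?_
    rcases (h0 l h₀).eq_or_lt with hz | hpos
    · rw [← hz, mul_zero, mul_zero, mul_zero]
    · have hm := hmonge l hl k hk (hPl l hpos.ne').2
      have : u l k ≤ u l₀ k / u l₀ h₀ * u l h₀ := by
        rw [div_mul_eq_mul_div, le_div_iff₀ hu0]; linarith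
      calc u l k * φ l h₀ ≤ (u l₀ k / u l₀ h₀ * u l h₀) * φ l h₀ := mul_le_mul_of_nonneg_right this hpos.le
        _ = u l₀ k / u l₀ h₀ * (u l h₀ * φ l h₀) := by ring
  -- the new flow, in additive form
  set φ' : ℕ → ℕ → ℝ := fun l h => if h = h₀ then (1 - θ) * φ l h₀ else φ l h + w h * θ * φ l h₀ with hφ'
  have hφ'add : ∀ l h, φ' l h = φ l h + θ * φ l h₀ * (w h - if h = h₀ then 1 else 0) := by
    intro l h; rw [hφ']; dsimp only
    split_ifs with hh
    · subst hh; rw [hwh]; ring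
    · ring
  have hrowsum : ∀ l ∈ L', ∑ h ∈ H, φ' l h = ∑ h ∈ H, φ l h := by
    intro l hl
    simp_rw [hφ'add]
    rw [Finset.sum_add_distrib, ← Finset.mul_sum, Finset.sum_sub_distrib, hw1, Finset.sum_ite_eq' H h₀]
    by_cases hh : h₀ ∈ H
    · rw [if_pos hh]; ring
    · rw [if_neg hh]
      have : φ l h₀ = 0 := by
        by_contra hne; exact hh (hsupp l h₀ hne).2.1
      rw [this]; ring
  refine ⟨φ', ⟨fun l h => ?_, fun l h hlh => ?_, fun l hl => ?_, fun h hh => ?_⟩, ?_⟩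
  · rw [hφ']; dsimp only; split_ifs
    · exact mul_nonneg (by linarith) (h0 l h₀)
    · exact add_nonneg (h0 l h) (mul_nonneg (mul_nonneg (hw0 h) hθ0) (h0 l h₀))
  · rw [hφ'] at hlh; dsimp only at hlh
    by_cases hh : h = h₀
    · rw [if_pos hh] at hlh; subst hh
      exact hsupp l h (by intro hz; rw [hz, mul_zero] at hlh; exact hlh rfl)
    · rw [if_neg hh] at hlh
      by_cases hφ0 : φ l h = 0
      · rw [hφ0, zero_add] at hlh
        have hwk : w h ≠ 0 := by intro hz; rw [hz, zero_mul, zero_mul] at hlh; exact hlh rfl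
        have hφh : φ l h₀ ≠ 0 := by intro hz; rw [hz, mul_zero] at hlh; exact hlh rfl
        obtain ⟨hl, hPl0⟩ := hPl l hφh
        exact ⟨hl, hwH h hwk, hcompat l hl h hwk hPl0⟩
      · exact hsupp l h hφ0
  · rw [hrowsum l hl]; exact hrow l hl
  · dsimp only
    by_cases hh0 : h = h₀
    · subst hh0
      rw [if_pos rfl, hwh]
      have e : ∑ l ∈ L', u l h * φ' l h = (1 - θ) * load := by
        rw [hload, Finset.mul_sum]; refine Finset.sum_congr rfl fun l _ => ?_
        rw [hφ']; dsimp only; rw [if_pos rfl]; ring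
      rw [e]; simp; linarith [hcap]
    · rw [if_neg hh0, sub_zero]
      have e : ∑ l ∈ L', u l h * φ' l h = (∑ l ∈ L', u l h * φ l h) + w h * θ * ∑ l ∈ L', u l h * φ l h₀ := by
        rw [Finset.mul_sum, ← Finset.sum_add_distrib]; refine Finset.sum_congr rfl fun l _ => ?_
        rw [hφ']; dsimp only; rw [if_neg hh0]; ring
      rw [e]
      have hc1 := hcol h hh
      by_cases hwk : w h = 0
      · rw [hwk]; simp; exact hc1
      · have hk0 : 0 ≤ u l₀ h := (hu _ _ (hwP h hwk)).le
        have h2 : w h * θ * ∑ l ∈ L', u l h * φ l h₀ ≤ w h * s * u l₀ h / u l₀ h₀ := by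
          calc w h * θ * ∑ l ∈ L', u l h * φ l h₀ ≤ w h * θ * (u l₀ h / u l₀ h₀ * load) :=
                mul_le_mul_of_nonneg_left (hmongeSum h hwk) (mul_nonneg (hw0 h) hθ0)
            _ = w h * (u l₀ h / u l₀ h₀) * (θ * load) := by ring
            _ ≤ w h * (u l₀ h / u l₀ h₀) * s :=
                mul_le_mul_of_nonneg_left hθload (mul_nonneg (hw0 h) (div_nonneg hk0 hu0.le))
            _ = w h * s * u l₀ h / u l₀ h₀ := by ring
        linarith
  · unfold val; exact Finset.sum_congr rfl fun l hl => hrowsum l hl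

end Greedy
end LawDec
end Quant
end Summit.CriticalPhenomena.PercolationContinuityZ3.Theorems
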